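import Literature.MathematicalPhysics.QuantumLattice.FinDimSpectrumSpectralGapProofs
import Mathlib.Analysis.Matrix.PosDef
import Mathlib.Data.ZMod.Basic
import HarnessLib

/-!
# Knabe's finite-size criterion for frustration-free rings, and the spectral-gap conclusion

Trunk **T-QLATTICE**. Sibling proof file of
`Literature/MathematicalPhysics/QuantumLattice/SpinChains.lean` (theorem-only, no definition or
named fact is introduced), second step towards `aklt_gap_holds`. It provides two
model-independent pieces of linear algebra:

* `knabe_ring_sq_sub_smul_posSemidef` — **Knabe's local gap inequality with four-site blocks on a
  ring.** Let `P : ℤ/N → M_n(ℂ)`, `N ≥ 5`, be orthogonal projections such that `P_i` and `P_{i+d}`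
  commute unless `d ∈ {0, ±1}` (nearest-neighbour bond projections), and suppose every block of
  three consecutive projections has local gap `ε`:
  `(P_i + P_{i+1} + P_{i+2})² ≥ ε (P_i + P_{i+1} + P_{i+2})`. Then `H = Σ_i P_i` satisfies
  `H² ≥ (3ε - 1)/2 · H`, i.e. the gap of the frustration-free Hamiltonian `H` above `0` is at least
  `(3/2)(ε - 1/3)` whenever `ε > 1/3`. This is the case `n = 4` (blocks of `n - 1 = 3`
  interactions, threshold `1/(n-1) = 1/3`) of Knabe's Theorem; the proof is the exact operator
  identity `H² - (3ε-1)/2 · H = ½ Σ_i (h_i² - ε h_i) + ½ Σ_i (P_i P_{i+2} + P_i P_{i-2})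
  + Σ_{d ∉ {0,±1,±2}} Σ_i P_i P_{i+d}` whose right side is a sum of positive operators (products of
  commuting projections are positive).
* `hasSpectralGap_of_sq_sub_smul_posSemidef` — **from `H² ≥ Δ H` to a spectral gap**: if `A` is
  Hermitian with a unique ground state and `(A - E₀)² - Δ (A - E₀) ≥ 0` (`E₀ = groundEnergy A`,
  `Δ > 0`), then `A.HasSpectralGap Δ` (every eigenvalue `λ` has `(λ - E₀)(λ - E₀ - Δ) ≥ 0` and
  `λ ≥ E₀`, hence `λ = E₀` or `λ ≥ E₀ + Δ`).

## Sources

S. Knabe, *Energy gaps and elementary excitations for certain VBS-quantum antiferromagnets*,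
J. Stat. Phys. **52** (1988) 627–638, §2 (the inequality `H² ≥ (n-1)/(n-2) (ε_n - 1/(n-1)) H`
for a periodic chain of projections with `n`-site open sub-chains of gap `ε_n`); restated as the
"finite-size criterion" in M. Lemm, A. W. Sandvik, S. Yang, *The AKLT model on a hexagonal chain
is gapped*, J. Stat. Phys. **177** (2019) 1077, arXiv:1904.01043, §2 (held), Thm. 2.1 and §2.2–2.4
(squaring the Hamiltonian, `H² = H + Q + R`, counting shifted subsystems), and in D. Gosset,
E. Mozgunov, J. Math. Phys. **57** (2016) 091901. The spectral conclusion is the finite-dimensional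
spectral theorem (Tasaki (2020) §2.1, App. A.2; Reed–Simon IV §XIII.1).
-/

noncomputable section

open Matrix Complex Finset
open scoped ComplexOrder

namespace Literature.MathematicalPhysics.QuantumLattice

section Knabe

variable {n : Type*} [Fintype n] [DecidableEq n]

/-! ### Products of commuting projections are positive -/

omit [DecidableEq n] in
/-- A Hermitian idempotent matrix is positive semidefinite (`P = Pᴴ P`). [folklore] -/
theorem posSemidef_of_isHermitian_of_mul_self {P : Matrix n n ℂ} (hP : P.IsHermitian)
    (hPP : P * P = P) : P.PosSemidef := by
  have h : P = Pᴴ * P := by rw [hP.eq, hPP]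
  rw [h]
  exact posSemidef_conjTranspose_mul_self P

omit [DecidableEq n] in
/-- **The product of two commuting orthogonal projections is positive**: `P Q = P Q P = Pᴴ Q P ≥ 0`.
Knabe (1988) §2 (the terms `h_i h_j`, `|i - j| ≥ 2`, of `H²` are positive); Lemm–Sandvik–Yang
(2019) §2.3 ("since `h_e` and `h_{e'}` commute in this case, `{h_e, h_{e'}} ≥ 0`"). [folklore] -/
theorem posSemidef_mul_of_commute {P Q : Matrix n n ℂ} (hP : P.IsHermitian) (hPP : P * P = P)
    (hQ : Q.IsHermitian) (hQQ : Q * Q = Q) (hPQ : P * Q = Q * P) : (P * Q).PosSemidef := by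
  have h : P * Q = Pᴴ * Q * P := by
    rw [hP.eq, mul_assoc, ← hPQ, ← mul_assoc, hPP]
  rw [h]
  exact (posSemidef_of_isHermitian_of_mul_self hQ hQQ).conjTranspose_mul_mul_same P

/-! ### Bookkeeping on the ring `ℤ/N` -/

/-- Distinct residues: for `a, b < N` with `a ≠ b`, `(a : ℤ/N) ≠ b`. [folklore] -/
theorem natCast_ne_natCast_zmod {N a b : ℕ} (ha : a < N) (hb : b < N) (hab : a ≠ b) :
    (a : ZMod N) ≠ (b : ZMod N) := by
  intro h
  rw [ZMod.natCast_eq_natCast_iff', Nat.mod_eq_of_lt ha, Nat.mod_eq_of_lt hb] at h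
  exact hab h

omit [DecidableEq n] in
/-- The "pair sums at distance `d`", `S(d) = Σ_i P_i P_{i+d}`, resum the square of `H = Σ_i P_i`:
`H² = Σ_d S(d)` (reindex `j = i + d`). Lemm–Sandvik–Yang (2019) §2.2 (`H² = H + Q + R`). [folklore] -/
theorem sum_mul_sum_eq_sum_sum_shift {N : ℕ} [NeZero N] (P : ZMod N → Matrix n n ℂ) :
    (∑ i, P i) * (∑ i, P i) = ∑ d : ZMod N, ∑ i : ZMod N, P i * P (i + d) := by
  rw [Finset.sum_mul_sum,
    show (∑ i, ∑ j, P i * P j) = ∑ i : ZMod N, ∑ d : ZMod N, P i * P (i + d) from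
      Finset.sum_congr rfl fun i _ => (Equiv.sum_comp (Equiv.addLeft i) (fun j => P i * P j)).symm]
  exact Finset.sum_comm

/-- Reindexing a ring sum by a shift: `Σ_i f(i + a) = Σ_i f(i)`. [folklore] -/
theorem sum_shift {N : ℕ} [NeZero N] {M : Type*} [AddCommMonoid M] (f : ZMod N → M)
    (a : ZMod N) : ∑ i : ZMod N, f (i + a) = ∑ i : ZMod N, f i :=
  Equiv.sum_comp (Equiv.addRight a) f

/-! ### Knabe's inequality -/

/-- **Knabe's finite-size criterion (four-site blocks, periodic chain).** Let `N ≥ 5` and let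
`P : ℤ/N → M_n(ℂ)` be orthogonal projections (`P_iᴴ = P_i = P_i²`) such that `P_i` commutes with
`P_{i+d}` for all `d ∉ {0, 1, -1}`. If every block of three consecutive projections satisfies the
local gap inequality `(P_i + P_{i+1} + P_{i+2})² - ε (P_i + P_{i+1} + P_{i+2}) ≥ 0`, then
`H = Σ_i P_i` satisfies `H² - ((3ε - 1)/2) H ≥ 0`; in particular, for `ε > 1/3`, the spectrum of
`H` lies in `{0} ∪ [(3/2)(ε - 1/3), ∞)`. This is Knabe's theorem
`H² ≥ (n-1)/(n-2) (ε_n - 1/(n-1)) H` for sub-chains of `n = 4` sites. Proof: the exact identity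
`H² - (3ε-1)/2 · H = ½ Σ_i (h_i² - ε h_i) + ½ (S(2) + S(-2)) + Σ_{d ∉ {0,±1,±2}} S(d)`,
`h_i = P_i + P_{i+1} + P_{i+2}`, `S(d) = Σ_i P_i P_{i+d}`, where `Σ_i h_i² = 3H + 2S(1) + 2S(-1)
+ S(2) + S(-2)`, `Σ_i h_i = 3H`, `H² = Σ_d S(d)`, `S(0) = H`, and `S(d) ≥ 0` for `d ∉ {0, ±1}`
(`posSemidef_mul_of_commute`). Knabe, J. Stat. Phys. 52 (1988) 627, §2; Lemm–Sandvik–Yang,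
J. Stat. Phys. 177 (2019) 1077, Thm. 2.1 and §2.2–2.4. [cite: Knabe1988, §2] -/
theorem knabe_ring_sq_sub_smul_posSemidef {N : ℕ} [NeZero N] (hN : 5 ≤ N)
    (P : ZMod N → Matrix n n ℂ) (hherm : ∀ i, (P i).IsHermitian) (hidem : ∀ i, P i * P i = P i)
    (hcomm : ∀ i d : ZMod N, d ≠ 0 → d ≠ 1 → d ≠ -1 → P i * P (i + d) = P (i + d) * P i)
    (ε : ℝ)
    (hloc : ∀ i : ZMod N, ((P i + P (i + 1) + P (i + 2)) * (P i + P (i + 1) + P (i + 2)) -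
      (ε : ℂ) • (P i + P (i + 1) + P (i + 2))).PosSemidef) :
    ((∑ i, P i) * (∑ i, P i) - (((3 * ε - 1) / 2 : ℝ) : ℂ) • ∑ i, P i).PosSemidef := by
  -- notation
  set H : Matrix n n ℂ := ∑ i, P i with hH
  set S : ZMod N → Matrix n n ℂ := fun d => ∑ i : ZMod N, P i * P (i + d) with hS
  set h : ZMod N → Matrix n n ℂ := fun i => P i + P (i + 1) + P (i + 2) with hh
  -- distinctness of `0, 1, -1, 2, -2` in `ℤ/N`, `N ≥ 5`
  have hm1 : (-1 : ZMod N) = ((N - 1 : ℕ) : ZMod N) := by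
    rw [Nat.cast_sub (by omega), ZMod.natCast_self, zero_sub, Nat.cast_one]
  have hm2 : (-2 : ZMod N) = ((N - 2 : ℕ) : ZMod N) := by
    rw [Nat.cast_sub (by omega), ZMod.natCast_self, zero_sub, Nat.cast_ofNat]
  have d01 : (0 : ZMod N) ≠ 1 := by
    exact_mod_cast natCast_ne_natCast_zmod (N := N) (a := 0) (b := 1) (by omega) (by omega) (by omega)
  have d0m1 : (0 : ZMod N) ≠ -1 := by
    rw [hm1]
    exact_mod_cast natCast_ne_natCast_zmod (N := N) (a := 0) (b := N - 1) (by omega) (by omega) (by omega)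
  have d02 : (0 : ZMod N) ≠ 2 := by
    exact_mod_cast natCast_ne_natCast_zmod (N := N) (a := 0) (b := 2) (by omega) (by omega) (by omega)
  have d0m2 : (0 : ZMod N) ≠ -2 := by
    rw [hm2]
    exact_mod_cast natCast_ne_natCast_zmod (N := N) (a := 0) (b := N - 2) (by omega) (by omega) (by omega)
  have d1m1 : (1 : ZMod N) ≠ -1 := by
    rw [hm1]
    exact_mod_cast natCast_ne_natCast_zmod (N := N) (a := 1) (b := N - 1) (by omega) (by omega) (by omega)
  have d12 : (1 : ZMod N) ≠ 2 := by
    exact_mod_cast natCast_ne_natCast_zmod (N := N) (a := 1) (b := 2) (by omega) (by omega) (by omega)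
  have d1m2 : (1 : ZMod N) ≠ -2 := by
    rw [hm2]
    exact_mod_cast natCast_ne_natCast_zmod (N := N) (a := 1) (b := N - 2) (by omega) (by omega) (by omega)
  have dm12 : (-1 : ZMod N) ≠ 2 := by
    rw [hm1]
    exact_mod_cast natCast_ne_natCast_zmod (N := N) (a := N - 1) (b := 2) (by omega) (by omega) (by omega)
  have dm1m2 : (-1 : ZMod N) ≠ -2 := by
    rw [hm1, hm2]
    exact natCast_ne_natCast_zmod (N := N) (by omega) (by omega) (by omega)
  have d2m2 : (2 : ZMod N) ≠ -2 := by
    rw [hm2]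
    exact_mod_cast natCast_ne_natCast_zmod (N := N) (a := 2) (b := N - 2) (by omega) (by omega) (by omega)
  -- positivity of the pair sums at distance `d ∉ {0, ±1}`
  have hSpos : ∀ d : ZMod N, d ≠ 0 → d ≠ 1 → d ≠ -1 → (S d).PosSemidef := by
    intro d hd0 hd1 hdm1
    exact posSemidef_sum _ fun i _ =>
      posSemidef_mul_of_commute (hherm i) (hidem i) (hherm _) (hidem _) (hcomm i d hd0 hd1 hdm1)
  -- (a) `H² = Σ_d S(d)`
  have hsq : H * H = ∑ d, S d := sum_mul_sum_eq_sum_sum_shift P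
  -- (b) `S(0) = H`
  have hS0 : S 0 = H := by
    simp only [hS, hH, add_zero, hidem]
  -- (c) `Σ_i h_i = 3 H`
  have hsumh : ∑ i, h i = (3 : ℂ) • H := by
    simp only [hh, hH, Finset.sum_add_distrib, sum_shift (fun i => P i) 1,
      sum_shift (fun i => P i) 2]
    module
  -- (d) `Σ_i h_i² = 3H + 2 S(1) + 2 S(-1) + S(2) + S(-2)`
  have hshift : ∀ a c : ZMod N, ∑ i, P (i + a) * P (i + a + c) = S c := fun a c =>
    Equiv.sum_comp (Equiv.addRight a) (fun i => P i * P (i + c))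
  have hS' : ∀ c : ZMod N, ∑ i, P i * P (i + c) = S c := fun c => rfl
  have hsumh2 : ∑ i, h i * h i =
      (3 : ℂ) • H + (2 : ℂ) • S 1 + (2 : ℂ) • S (-1) + S 2 + S (-2) := by
    have e : ∀ i, h i * h i =
        P i * P (i + 0) + P (i + 1) * P (i + 1 + 0) + P (i + 2) * P (i + 2 + 0) +
        P i * P (i + 1) + P (i + 1) * P (i + 1 + 1) +
        P (i + 1) * P (i + 1 + -1) + P (i + 2) * P (i + 2 + -1) +
        P i * P (i + 2) + P (i + 2) * P (i + 2 + -2) := by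
      intro i
      have e1 : i + 1 + 1 = i + 2 := by ring
      have e2 : i + 1 + -1 = i := by ring
      have e3 : i + 2 + -1 = i + 1 := by ring
      have e4 : i + 2 + -2 = i := by ring
      simp only [hh, add_zero, e1, e2, e3, e4, add_mul, mul_add]
      abel
    simp only [e, Finset.sum_add_distrib]
    rw [hS' 0, hshift 1 0, hshift 2 0, hS' 1, hshift 1 1, hshift 1 (-1), hshift 2 (-1), hS' 2,
      hshift 2 (-2), hS0]
    module
  -- (e) split `Σ_d S(d)` off the five distances `0, 1, -1, 2, -2`
  have hsum5 : ∑ d ∈ ({0, 1, -1, 2, -2} : Finset (ZMod N)), S d =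
      S 0 + S 1 + S (-1) + S 2 + S (-2) := by
    rw [Finset.sum_insert, Finset.sum_insert, Finset.sum_insert, Finset.sum_pair d2m2]
    · abel
    · simp only [Finset.mem_insert, Finset.mem_singleton, not_or]; exact ⟨dm12, dm1m2⟩
    · simp only [Finset.mem_insert, Finset.mem_singleton, not_or]; exact ⟨d1m1, d12, d1m2⟩
    · simp only [Finset.mem_insert, Finset.mem_singleton, not_or]; exact ⟨d01, d0m1, d02, d0m2⟩
  set T : Finset (ZMod N) := univ \ {0, 1, -1, 2, -2} with hT
  have hsplit : ∑ d, S d = S 0 + S 1 + S (-1) + S 2 + S (-2) + ∑ d ∈ T, S d := by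
    rw [← Finset.sum_sdiff (Finset.subset_univ ({0, 1, -1, 2, -2} : Finset (ZMod N))), hsum5,
      add_comm]
  have hTpos : (∑ d ∈ T, S d).PosSemidef := by
    refine posSemidef_sum _ fun d hd => ?_
    simp only [hT, Finset.mem_sdiff, Finset.mem_univ, true_and, Finset.mem_insert,
      Finset.mem_singleton, not_or] at hd
    exact hSpos d hd.1 hd.2.1 hd.2.2.1
  -- (f) the identity
  have hid : H * H - (((3 * ε - 1) / 2 : ℝ) : ℂ) • H =
      (1 / 2 : ℂ) • (∑ i, (h i * h i - (ε : ℂ) • h i)) +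
        (1 / 2 : ℂ) • (S 2 + S (-2)) + ∑ d ∈ T, S d := by
    rw [Finset.sum_sub_distrib, ← Finset.smul_sum, hsumh2, hsumh, hsq, hsplit, hS0]
    push_cast
    module
  rw [hid]
  have hhalf : (0 : ℂ) ≤ 1 / 2 := by
    rw [show (1 / 2 : ℂ) = ((1 / 2 : ℝ) : ℂ) by push_cast; ring]
    exact Complex.zero_le_real.2 (by norm_num)
  refine PosSemidef.add (PosSemidef.add ?_ ?_) hTpos
  · exact PosSemidef.smul (posSemidef_sum _ fun i _ => hloc i) hhalf
  · exact PosSemidef.smul ((hSpos 2 d02.symm d12.symm dm12.symm).add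
      (hSpos (-2) d0m2.symm d1m2.symm dm1m2.symm)) hhalf

/-! ### From `(A - E₀)² ≥ Δ (A - E₀)` to a spectral gap -/

/-- **Spectral gap from a quadratic operator inequality.** Let `A` be Hermitian with a unique
ground state (`dim ker (A - E₀) = 1`, `E₀ = groundEnergy A`) and suppose
`(A - E₀)² - Δ (A - E₀) ≥ 0` for some `Δ > 0`. Then `A.HasSpectralGap Δ`: every eigenvalue `λ`
of `A` satisfies `λ ≥ E₀` and `(λ - E₀)(λ - E₀ - Δ) = ⟨v, ((A-E₀)² - Δ(A-E₀)) v⟩ ≥ 0` on its unit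
eigenvector `v`, hence `λ = E₀` or `λ ≥ E₀ + Δ` (`IsHermitian.hasSpectralGap_iff_card_filter`).
This is how frustration-free gap bounds `H² ≥ γ H` are read (Knabe (1988) §2, "the gap is the
largest `ε` with `H² ≥ ε H`"; Tasaki (2020) §2.1, App. A.2). [folklore] -/
theorem hasSpectralGap_of_sq_sub_smul_posSemidef {A : Matrix n n ℂ} (hA : A.IsHermitian)
    (huniq : A.HasUniqueGroundState) {Δ : ℝ} (hΔ : 0 < Δ)
    (hsq : ((A - algebraMap ℝ (Matrix n n ℂ) A.groundEnergy) *
        (A - algebraMap ℝ (Matrix n n ℂ) A.groundEnergy) -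
        (Δ : ℂ) • (A - algebraMap ℝ (Matrix n n ℂ) A.groundEnergy)).PosSemidef) :
    A.HasSpectralGap Δ := by
  rw [hA.hasSpectralGap_iff_card_filter]
  refine ⟨hΔ, ?_, ?_⟩
  · rw [hA.card_filter_eigenvalues_eq]
    exact huniq
  · rintro _ ⟨i, rfl⟩
    set E₀ := A.groundEnergy
    set μ : ℝ := hA.eigenvalues i - E₀ with hμ
    have hμ0 : 0 ≤ μ := sub_nonneg.2 (groundEnergy_le_eigenvalues hA i)
    -- the unit eigenvector
    set v : n → ℂ := ⇑(hA.eigenvectorBasis i) with hv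
    have hAv : A *ᵥ v = ((hA.eigenvalues i : ℝ) : ℂ) • v := by
      have h := hA.mulVec_eigenvectorBasis i
      rw [RCLike.real_smul_eq_coe_smul (K := ℂ)] at h
      exact h
    have halg : algebraMap ℝ (Matrix n n ℂ) E₀ = ((E₀ : ℝ) : ℂ) • (1 : Matrix n n ℂ) := by
      rw [Algebra.algebraMap_eq_smul_one, Complex.coe_smul]
    set B : Matrix n n ℂ := A - algebraMap ℝ (Matrix n n ℂ) E₀ with hB
    have hBv : B *ᵥ v = ((μ : ℝ) : ℂ) • v := by
      rw [hB, halg, sub_mulVec, hAv, smul_mulVec, one_mulVec, hμ, Complex.ofReal_sub, sub_smul]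
    have hMv : (B * B - (Δ : ℂ) • B) *ᵥ v = ((μ * μ - Δ * μ : ℝ) : ℂ) • v := by
      rw [sub_mulVec, ← mulVec_mulVec, hBv, mulVec_smul, hBv, smul_mulVec, hBv, smul_smul,
        smul_smul, ← sub_smul]
      push_cast
      ring_nf
    have hvv : star v ⬝ᵥ v = 1 := by
      have h1 : ‖hA.eigenvectorBasis i‖ = 1 := hA.eigenvectorBasis.orthonormal.1 i
      rw [hv, dotProduct_comm, ← EuclideanSpace.inner_eq_star_dotProduct,
        inner_self_eq_norm_sq_to_K, h1]
      simp
    have hq := hsq.dotProduct_mulVec_nonneg v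
    rw [hMv, dotProduct_smul, hvv, smul_eq_mul, mul_one, Complex.zero_le_real] at hq
    -- `μ (μ - Δ) ≥ 0` with `μ ≥ 0`: `μ = 0` or `μ ≥ Δ`
    rw [Set.mem_union, Set.mem_singleton_iff, Set.mem_Ici]
    by_cases hμz : μ = 0
    · left
      have : hA.eigenvalues i - E₀ = 0 := hμz
      linarith
    · right
      have hμpos : 0 < μ := lt_of_le_of_ne hμ0 (Ne.symm hμz)
      have hge : Δ ≤ μ := by
        by_contra hlt
        rw [not_le] at hlt
        have : μ * μ - Δ * μ < 0 := by nlinarith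
        linarith
      have : hA.eigenvalues i - E₀ = μ := rfl
      linarith

end Knabe

end Literature.MathematicalPhysics.QuantumLattice
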